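import Mathlib
import Summits.Ventures.PercRepro2.Defs
import Summits.Ventures.PercRepro2.Graph
import Summits.Ventures.PercRepro2.OneColourSwitch
import Summits.Ventures.PercRepro2.RegionHubSign
import Summits.Ventures.PercRepro2.SideSwitch
import Summits.Ventures.PercRepro2.TermSwitchDefs
import Summits.Ventures.PercRepro2.TermSwitchReach
import Summits.Ventures.PercRepro2.M9NoPocketDefs
import Summits.Ventures.PercRepro2.M9Unreached
import Summits.Ventures.PercRepro2.M9GeneralDSplit
import Summits.Ventures.PercRepro2.M9PocketCubeDefs
import Summits.Ventures.PercRepro2.M9PocketCubeFibre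
import Summits.Ventures.PercRepro2.M9PocketRepAB

/-!
# REACH: the reached one-sided part of the single-`d` sum is non-positive — the `DZero` sum is
dominated by its unreached part, and the hub–dead-end sum by minus the clean reached part
(blind cell PercRepro2, p3 g30, 2026-08-28; `proofs/P3-HDR.md` §7(b), §9)

`reachedOneSum = Σ_{Sep ∧ DOne ∧ d in exactly one world} σ_pq σ_rs` is the sum over the pocket
representatives of p3 g25's one-sided sums `abSum ρ₀ ≤ 0` (`M9PocketRepAB`, via the fibration
`sum_dOne_eq_sum_repP_legalP`), hence **`reachedOneSum ≤ 0`** (`reachedOneSum_nonpos`) — the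
conjecture REACH of the census.  Consequences: the `DZero` sum `Σ_{Sep ∧ DOne ∧ ¬(d ∈ K₂ ∩ M₂)}`
is at most the unreached sum (`dzeroOneSum_le_unreachedSum`), and the hub–dead-end sum is at most
minus the CLEAN reached one-sided sum (`hdSum_le_neg_cleanReachedSum`): wherever `hdSum > 0`
(the `T`-edge witnesses of `proofs/P3-HDR.md` §8) the clean reached points pay.  Own work; std
axioms.
-/

namespace Summit.Ventures.PercRepro2

namespace NoPocket

open Finset Classical RegionHub OneColourSwitch SideSwitch TermSwitch

variable {V : Type*} {E : Type*}

section Reached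

variable [Fintype V] [DecidableEq V] [Fintype E] [DecidableEq E] {ends : E → Sym2 V}
  {p q r s d : V}

/-- `d` lies in exactly one world of `{r, s}`. -/
def OneSided (ends : E → Sym2 V) (r s d : V) (ω : Config E) : Prop :=
  (d ∈ K2 ends r s ω ∨ d ∈ M2 ends r s ω) ∧ ¬ (d ∈ K2 ends r s ω ∧ d ∈ M2 ends r s ω)

/-- The reached one-sided sum `Σ_{Sep ∧ DOne ∧ d in exactly one world} σ_pq σ_rs`. -/
noncomputable def reachedOneSum (ends : E → Sym2 V) (p q r s d : V) : ℤ :=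
  ∑ ω : Config E, if sep2 ends p q r s ω ∧ DOne ends r s d ω ∧ OneSided ends r s d ω then
    sigma ends ω p q * sigma ends ω r s else 0

/-- The clean reached one-sided sum: the reached one-sided colourings that are `Sep_H ∧ DZero_H`
for `H = {r, s, d}`. -/
noncomputable def cleanReachedSum (ends : E → Sym2 V) (p q r s d : V) : ℤ :=
  ∑ ω : Config E, if sep2 ends p q r s ω ∧ DOne ends r s d ω ∧ OneSided ends r s d ω ∧
      (sepH ends p q ({r, s, d} : Set V) ω ∧ DZeroH ends ({r, s, d} : Set V) ω) then
    sigma ends ω p q * sigma ends ω r s else 0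

/-- The `DZero` sum of the pair `{r, s}`, written on the single-`d` family: `Sep ∧ DOne` with `d`
not doubly reached. -/
noncomputable def dzeroOneSum (ends : E → Sym2 V) (p q r s d : V) : ℤ :=
  ∑ ω : Config E, if sep2 ends p q r s ω ∧ DOne ends r s d ω ∧
      ¬ (d ∈ K2 ends r s ω ∧ d ∈ M2 ends r s ω) then
    sigma ends ω p q * sigma ends ω r s else 0

/-- **REACH: the reached one-sided sum is non-positive** — the sum over the pocket representatives
of the one-sided sums `abSum ρ₀ ≤ 0`. -/
theorem reachedOneSum_nonpos (hr : d ≠ r) (hs : d ≠ s) : reachedOneSum ends p q r s d ≤ 0 := by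
  have h1 : reachedOneSum ends p q r s d = ∑ ω ∈ DOneSet ends p q r s d,
      (if OneSided ends r s d ω then sigma ends ω p q * sigma ends ω r s else 0) := by
    unfold reachedOneSum DOneSet
    rw [Finset.sum_filter]
    refine Finset.sum_congr rfl fun ω _ => ?_
    by_cases h : sep2 ends p q r s ω ∧ DOne ends r s d ω
    · simp [h]
    · have h' : ¬ (sep2 ends p q r s ω ∧ DOne ends r s d ω ∧ OneSided ends r s d ω) :=
        fun h' => h ⟨h'.1, h'.2.1⟩
      simp [h, h']
  rw [h1, sum_dOne_eq_sum_repP_legalP hr hs]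
  refine Finset.sum_nonpos fun ρ hρ => ?_
  have h2 : ∑ x ∈ LegalP ends p q r s d ρ,
      (if OneSided ends r s d (assignX ends x ρ) then
        sigma ends (assignX ends x ρ) p q * sigma ends (assignX ends x ρ) r s else 0) =
      abSum ends p q r s d ρ := by
    unfold abSum OneSided
    refine Finset.sum_congr rfl fun x _ => ?_
    by_cases h : (d ∈ K2 ends r s (assignX ends x ρ) ∨ d ∈ M2 ends r s (assignX ends x ρ)) ∧
        ¬ (d ∈ K2 ends r s (assignX ends x ρ) ∧ d ∈ M2 ends r s (assignX ends x ρ))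
    · rw [if_pos h, if_pos h]
    · rw [if_neg h, if_neg h]
  rw [h2]
  exact abSum_nonpos hr hs hρ

omit [Fintype V] [DecidableEq V] [Fintype E] [DecidableEq E] in
/-- The pointwise split of the `DZero` family into the unreached and the reached one-sided
colourings. -/
lemma dzeroOne_term_split (ω : Config E) :
    (if sep2 ends p q r s ω ∧ DOne ends r s d ω ∧ ¬ (d ∈ K2 ends r s ω ∧ d ∈ M2 ends r s ω) then
        sigma ends ω p q * sigma ends ω r s else 0) =
      (if sep2 ends p q r s ω ∧ DOne ends r s d ω ∧ d ∉ K2 ends r s ω ∧ d ∉ M2 ends r s ω then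
        sigma ends ω p q * sigma ends ω r s else 0) +
      (if sep2 ends p q r s ω ∧ DOne ends r s d ω ∧ OneSided ends r s d ω then
        sigma ends ω p q * sigma ends ω r s else 0) := by
  by_cases h0 : sep2 ends p q r s ω ∧ DOne ends r s d ω
  · by_cases hK : d ∈ K2 ends r s ω <;> by_cases hM : d ∈ M2 ends r s ω
    · simp [h0, hK, hM, OneSided]
    · simp [h0, hK, hM, OneSided]
    · simp [h0, hK, hM, OneSided]
    · simp [h0, hK, hM, OneSided]
  · rw [if_neg (fun h => h0 ⟨h.1, h.2.1⟩), if_neg (fun h => h0 ⟨h.1, h.2.1⟩),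
      if_neg (fun h => h0 ⟨h.1, h.2.1⟩), add_zero]

omit [Fintype V] [DecidableEq V] in
/-- **The `DZero` sum is the unreached sum plus the reached one-sided sum.** -/
theorem dzeroOneSum_eq_add :
    dzeroOneSum ends p q r s d = unreachedSum ends p q r s d + reachedOneSum ends p q r s d := by
  unfold dzeroOneSum unreachedSum reachedOneSum
  rw [← Finset.sum_add_distrib]
  exact Finset.sum_congr rfl fun ω _ => dzeroOne_term_split ω

/-- **The `DZero` sum is dominated by its unreached part**, for every non-mark `d`. -/
theorem dzeroOneSum_le_unreachedSum (hr : d ≠ r) (hs : d ≠ s) :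
    dzeroOneSum ends p q r s d ≤ unreachedSum ends p q r s d := by
  rw [dzeroOneSum_eq_add]
  have := reachedOneSum_nonpos (ends := ends) (p := p) (q := q) hr hs
  linarith

omit [Fintype V] [DecidableEq V] [Fintype E] [DecidableEq E] in
/-- An `HD` colouring is reached one-sided and not clean. -/
lemma oneSided_of_HD {ω : Config E} (h : HD ends p q r s d ω) : OneSided ends r s d ω := by
  obtain ⟨_, _, hone, _⟩ := hd_iff_dzero.1 h
  rcases hone with ⟨hK, hM⟩ | ⟨hM, hK⟩
  · exact ⟨Or.inl hK, fun h' => hM h'.2⟩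
  · exact ⟨Or.inr hM, fun h' => hK h'.1⟩

omit [Fintype V] [DecidableEq V] [Fintype E] [DecidableEq E] in
/-- The pointwise split of the reached one-sided colourings into the clean ones and the
hub–dead-end ones. -/
lemma reachedOne_term_split (ω : Config E) :
    (if sep2 ends p q r s ω ∧ DOne ends r s d ω ∧ OneSided ends r s d ω then
        sigma ends ω p q * sigma ends ω r s else 0) =
      (if sep2 ends p q r s ω ∧ DOne ends r s d ω ∧ OneSided ends r s d ω ∧
          (sepH ends p q ({r, s, d} : Set V) ω ∧ DZeroH ends ({r, s, d} : Set V) ω) then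
        sigma ends ω p q * sigma ends ω r s else 0) +
      (if HD ends p q r s d ω then sigma ends ω p q * sigma ends ω r s else 0) := by
  by_cases h0 : sep2 ends p q r s ω ∧ DOne ends r s d ω ∧ OneSided ends r s d ω
  · obtain ⟨hsep, hD, hone⟩ := h0
    by_cases hL : sepH ends p q ({r, s, d} : Set V) ω ∧ DZeroH ends ({r, s, d} : Set V) ω
    · have hHD : ¬ HD ends p q r s d ω := fun h => h.2.2.2 hL
      simp [hsep, hD, hone, hL, hHD]
    · have hHD : HD ends p q r s d ω := ⟨hsep, hD, by
        rcases hone.1 with h | h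
        · exact Or.inl h
        · exact Or.inr h, hL⟩
      simp [hsep, hD, hone, hL, hHD]
  · have hHD : ¬ HD ends p q r s d ω := fun h => h0 ⟨h.1, h.2.1, oneSided_of_HD h⟩
    rw [if_neg h0, if_neg (fun h => h0 ⟨h.1, h.2.1, h.2.2.1⟩), if_neg hHD, add_zero]

omit [Fintype V] [DecidableEq V] in
/-- **The reached one-sided sum is the clean reached sum plus the hub–dead-end sum.** -/
theorem reachedOneSum_eq_clean_add_hd :
    reachedOneSum ends p q r s d = cleanReachedSum ends p q r s d + hdSum ends p q r s d := by
  unfold reachedOneSum cleanReachedSum hdSum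
  rw [← Finset.sum_add_distrib]
  exact Finset.sum_congr rfl fun ω _ => reachedOne_term_split ω

/-- **The hub–dead-end sum is at most minus the clean reached sum**: wherever `hdSum > 0`, the
clean reached one-sided colourings pay. -/
theorem hdSum_le_neg_cleanReachedSum (hr : d ≠ r) (hs : d ≠ s) :
    hdSum ends p q r s d ≤ - cleanReachedSum ends p q r s d := by
  have h1 := reachedOneSum_nonpos (ends := ends) (p := p) (q := q) hr hs
  rw [reachedOneSum_eq_clean_add_hd] at h1
  linarith

end Reached

end NoPocket

end Summit.Ventures.PercRepro2
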